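import Summits.QuantumFields.YangMills.Theorems.BalabanUVNodesK0RecordFormatNamesLemmas16
import Summits.QuantumFields.YangMills.Theorems.BalabanUVNodesK0AxJunctionHessBoxD9

/-!
# P3 g91 №15 v1.1 — (T-β3) «FINITE-VOLUME KERNELS CONTINUOUS IN THE HISTORY» IS FED BY THE K0 JUNCTION ROAD's (V-hess-cont-box) ROW: ONE HESSIAN-CONTINUITY LETTER FOR BOTH ROADS;
# AND THE JUNCTION BODY's BILL IN THE (T-β) CURRENCY AT `thetaFill` — LENS P3 «weaken the target»

LANDING NOTE (porter ▶ PTC-1 g4, 2026-08-31; AUTHORSHIP = ★ P3 g91 «weaken the target», HOME sketch `nodeO-cover/P3-HistContOfHessCont-v1p1.lean` sha16 64ed37c7e2d6f329 · 199 l. · 2 def (displayed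
letters `HessHistContOnBoxOf`, `HessHistContOnBox₁₃Ax`) + 11 thm · 0 sorry (№15 v1.1)): landed VERBATIM (only this paragraph added) under the basename ★★★ director-ym g22 №571 (1) named
(`…Theorems/BalabanUVNodesK0AxHistContOfHess.lean`, «W-AI UN-STALLED — №15 v1.1 PEN = ▶ PTC-1, INTENT-63 right after INTENT-62», 12:06:20Z), `--supports stmt-QuantumFields-27238 --as helper` (NO
`--workitem`; kind definition → async audit); ◆ CRIT-1 g37's cut∕GO of №15 v1.1 stands (its ■ seat-close line 11:45:16Z: «№15 v1.1 GO stands; custody of its ✓p is my successor's: declcmp 13∕13 vs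
`g37/P3_N15_v1p1.lean` + axioms on `…record13SepCoPHInhabitedAx_of_letters₁₃Ax_thetaFill_negPart_cofinalRadii`»); imports ✓`…K0RecordFormatNamesLemmas16` (DEF-1) + ✓p820772
`…K0AxJunctionHessBoxD9`.  HONEST (porter): CONDITIONAL theorems ∕ doors over DISPLAYED letters inhabited NOWHERE; nothing of Bałaban asserted, ported, discharged or refuted; K0ᴬ
stmt-QuantumFields-27238 OPEN — NOTHING of it proved; K1ᴬ 27239 ∕ K3ᴬ 27247 OPEN; NODE O 0∕1; COUNT 8∕28 · K 1∕4 UNMOVED; finite 𝕋⁴ at fixed ε — NOT continuum ∕ OS ∕ Clay; the Yang–Mills mass gap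
is NOT proved by any of this.

ym-nodeO-ideate ★ P3 g91 (count-neutral author seat; v1.1 = g90's №15 v1 f0f2f002d08cfb18 re-homed to its own K0Ax-side namespace + §5; sketch OFFERED to ◆ CRIT-1 ∕ ▶ PTC-1 — P3 files nothing).  WHAT THIS FILE DOES, exactly.  ★★ DEF-1's ED.25 types
(T-β3) `PvolHistContOnBoxOf F fam ρ bV γ := ∀ k K z, ContinuousOn (v ↦ pvolOf F fam ρ bV k v K 0 1 z) (Box γ k)` («the one letter plausibly provable outright at finite 𝕋⁴»).
The K0 junction road ALREADY displays a chart-free, basis-free, window-free row one level below it — ✓`K0AxMomentRoad.recordPvolContOnBoxAx_of_hessContOnBox` (№10, ✓p820772 :86):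
«the Hessian at the origin of `W ↦ expChart (fam k v K) ρ W` is continuous in the box history `v`» ⟹ (V-cont-box) — through the generic calculus step
✓`continuousOn_polWindow_of_hessCont` (:73; `pvolOf … k v K μ ν z` IS `polWindow F K (k+1) (fam k v K) ρ bV μ ν z`, definitional).  Here:
§1 the generic letter `HessHistContOnBoxOf F fam ρ γ` (bV-FREE) and ★`pvolHistContOnBoxOf_of_hess : HessHistContOnBoxOf F fam ρ γ → PvolHistContOnBoxOf F fam ρ bV γ` for EVERY
   window basis `bV` (3 lines over ✓:73) + monotonicity;
§2 the Stage-13-Ax instance `HessHistContOnBox₁₃Ax F N θ γ` (DEF-1's ED.25 idiom: the generic letter at `(famOfRecord₁₃Ax F N θ, θ.ρ8)`) and `pvolHistContOnBox₁₃Ax_of_hess`;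
§3 the (C) face with (T-β3) REPLACED by the Hessian row: `survCont_betaOfRecord₁₃Ax_of_locUnif_decay_hess` (DEF-1's ★★`survCont_betaOfRecord₁₃Ax_of_letters₁₃Ax` ∘ §2);
§4 at `thetaFill F a₀ ε₂₉`: `hessHistContOnBox₁₃Ax_thetaFill_iff` (`Iff.rfl`) — the instance IS №10's displayed row `∀ k K, ContinuousOn (v ↦ D²(expChart (recordTermsAx F a₀ ε₂₉ k v K) θ.ρ8)(0)) (Box γ k)`
   BYTE-SHAPED, so ONE row feeds (V-cont-box) (№10 :86, K0 junction road), (T-β3) at the K0 instance (ED.25's `pvolHistContOnBox₁₃Ax_thetaFill_iff`), and (T-β3) at every θ;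
§5 THE JUNCTION BODY's BILL IN THE (T-β) CURRENCY (LENS-P3 edge row; replaces g90's retired №14 §2): the K0ᴬ–K1ᴬ junction's binder body `CofinalBetaSocketAxBody F a` (|β|-box + run rows (i),
   (iv), (C) at a cofinal re-centred member) is inhabited at ONE radius `0 < a₀ ≤ a`, level `0 < γ₀ ≤ ½`, from DEF-1's THREE NAMED LETTERS (T-β1) `PolLimitLocUnifOnBox₁₃Ax` + (T-β2)
   `PlimDecayOnBox₁₃Ax … C δ₁` + (T-β3) `PvolHistContOnBox₁₃Ax` AT `thetaFill F a₀ ε₂₉` on the box of side `γ₀` — the SAME three letters K1ᴬ's `stub_cont13` doors read at a Stage-13-Ax `θ` —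
   PLUS the one signed letter (L-negpart-box) `e` (or (L-AF-box) `k₀`): ★★`cofinalBetaSocketAxBody_of_letters₁₃Ax_thetaFill_negPart` ∕ `…_eventuallyNonneg` (= ✓`cofinalBetaSocketAxBody_of_plimBoxLetters`
   with (L-absmom-box) `M := β′₅.₁₀ = betaPrime510 4 C δ₁` ⟸ (T-β2) (✓`recordPlimAbsMomentOnBoxAx_of_plimDecayOnBoxOf`), (L-cont-box) ⟸ (T-β1)+(T-β3) (✓`plimContOnBoxOf_of_locUnif_of_histCont`),
   (L-dom-box) ⟸ (T-β2) (✓`plimMomentDominatedOnBoxOf_of_plimDecayOnBoxOf`), every key `Iff.rfl`∕`rfl` at the K0 instance); the Hessian-row variant `…_of_locUnif_decay_hess_thetaFill_negPart` (§2);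
   the junction's `hβc` VERBATIM at cofinally small radii and K0ᴬ BY NAME through the socket's projection.  EDGE CONTENT: in the (T-β) currency the junction's bill is «three kernel letters
   + ONE sign letter»; the sign letter ((iv), [I] (5.38)–(5.44)) is the only junction row no kernel-size∕regularity letter pays.  DOMINATION NOTE (why §5 is about the JUNCTION, not the
   leaf): for K0ᴬ ALONE (T-β2) at `thetaFill` at cofinal radii already suffices — ✓`record13SepCoPHInhabitedAx_of_plimDecayOnBox_cofinalRadii` + ✓`plimDecayOnBox₁₃Ax_thetaFill_iff`.
WHAT IT IS NOT.  The Hessian row is OPEN at the record (the merged family (1.6) reads the history through `printedSeq … g` — `A_{k+1} = nextAction (T_k) (χ_k) (GF_k) (g_k) A_k`, [I] (0.19) —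
and through `−(1∕g_0²)A`; only the re-centred χ-slot is history-blind (`chiβOfRecord₁₃Ax_flowBlind`, `rfl`)); its discharge from the record's primitives (continuity of the β-layer transport
`TβOfRecord₁₃` and of `nextAction` in `(g_k, A_k)`, then C²-in-the-field with v-continuous Hessian) is NOT attempted here — that is the provenance question DEF-1's (T-β3) census owns.

HONEST FRAMING.  CONDITIONAL order lemmas + display instances + `Iff.rfl`; NOTHING of Bałaban is asserted, ported or discharged; (T-β1)+(T-β2) = [I] §1∕§5 at the record and the Hessian
row are DISPLAYED, discharged by nobody; `stub_cont13` NOT closed; K1ᴬ 0∕6; K0ᴬ ∕ K1ᴬ ∕ K3ᴬ 0∕3; NODE O `B13TermWalkDataOneTorus.ExistsUniformAcrossSmall` NOT inhabited (0∕1); COUNT 8∕28 ·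
K 1∕4 UNMOVED; finite `𝕋⁴_{L^K}` at fixed ε — NOT continuum ∕ ℝ⁴ ∕ OS; R4 = the conditional `BalabanLadder.UV` rung only; **the Yang–Mills mass gap (Clay) is NOT proved by any of this.**
No `sorry`, `instance`, `notation`; standard axioms.
-/

noncomputable section

open scoped BigOperators Matrix.Norms.L2Operator Topology
open Set Filter

namespace Summit.QuantumFields.YangMills.Theorems.K0AxHistContOfHess

open Literature.MathematicalPhysics.QuantumFieldTheory.Balaban1983to89
open Literature.MathematicalPhysics.QuantumFieldTheory.Balaban1983to89.Node00
open Literature.MathematicalPhysics.QuantumFieldTheory.Balaban1983to89.T4Continuum (T4Family)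
open Literature.MathematicalPhysics.QuantumFieldTheory.Balaban1983to89.FlowStep
open Summit.QuantumFields.YangMills.Theorems.K0RecordFormatNames
open Summit.QuantumFields.YangMills.Theorems.K0AxMomentRoad (RecordPvolContOnBoxAx continuousOn_polWindow_of_hessCont recordPvolContOnBoxAx_of_hessContOnBox
  RecordPlimMomentNegPartOnBoxAx RecordPlimMomentEventuallyNonnegOnBoxAx CofinalBetaSocketAxBody recordPlimAbsMomentOnBoxAx_of_plimDecayOnBoxOf
  cofinalBetaSocketAxBody_of_plimBoxLetters cofinalBetaSocketAxBody_of_plimBoxLetters_eventuallyNonneg record13SepCoPHInhabitedAx_of_cofinalBetaSocketAxBody)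
open Summit.QuantumFields.YangMills.Theorems.BalabanUVNodesK2NamedJetsRunRemAt (SurvCont)

section Generic

variable (F : T4Family)
variable {𝔄 : Type*} [NormedRing 𝔄] [NormedAlgebra ℝ 𝔄]
variable {V : Type*} [NormedAddCommGroup V] [NormedSpace ℝ V] {ι : Type*} [Fintype ι]
variable (fam : TermFamily1 F 𝔄) (ρ : V →L[ℝ] 𝔄) (bV : Module.Basis ι ℝ V)

/-! ## §1  The generic Hessian-continuity letter and (T-β3) from it -/

/-- **(V-hess-cont-box), GENERIC over a term family — «THE HESSIAN AT THE ORIGIN OF `W ↦ expChart (fam k v K) ρ W` IS CONTINUOUS IN THE BOX HISTORY `v`», at every step `k` and volume `K`**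
(chart-free, basis-free, window-free; the row ✓`recordPvolContOnBoxAx_of_hessContOnBox` displays at the K0 instance).  HYPOTHESIS SHAPE; asserts nothing; OPEN at the record.
[cite: Balaban1987RG1, (1.20)–(1.22) p.264, p.266, p.298] -/
def HessHistContOnBoxOf (γ : ℝ) : Prop :=
  ∀ k K : ℕ, ContinuousOn (fun v : Fin (k + 1) → ℝ => fderiv ℝ (fderiv ℝ (B12PolarizationTensor120.expChart (fam k v K) ρ)) 0) (Box γ k)

/-- ★ **(V-hess-cont-box) ⟹ (T-β3) `PvolHistContOnBoxOf`, for EVERY window basis `bV`** — `pvolOf F fam ρ bV k v K 0 1 z` is `polWindow F K (k+1) (fam k v K) ρ bV 0 1 z` (definitional),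
the normalised colour trace of that Hessian on two fixed one-bond directions (✓`continuousOn_polWindow_of_hessCont`). [cite: Balaban1987RG1, (1.20)–(1.21) p.264] -/
theorem pvolHistContOnBoxOf_of_hess {γ : ℝ} (h : HessHistContOnBoxOf F fam ρ γ) : PvolHistContOnBoxOf F fam ρ bV γ :=
  fun k K z => continuousOn_polWindow_of_hessCont F K (k + 1) (fun v : Fin (k + 1) → ℝ => fam k v K) ρ bV 0 1 z (h k K)

/-- Monotonicity of the Hessian letter in the box side. [cite: Balaban1987RG1, (1.20) p.264 (bookkeeping)] -/
theorem hessHistContOnBoxOf_mono {γ γ' : ℝ} (hle : γ' ≤ γ) (h : HessHistContOnBoxOf F fam ρ γ) : HessHistContOnBoxOf F fam ρ γ' :=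
  fun k K => (h k K).mono (FlowStep.box_mono hle k)

end Generic

/-! ## §2  The Stage-13-Ax instance -/

section Stage13Ax

variable (F : T4Family) (N : ℕ) [NeZero N]

/-- **(V-hess-cont-box) AT THE STAGE-13-Ax RECORD `θ`** on the box of side `γ`: the generic letter at `(famOfRecord₁₃Ax F N θ, θ.ρ8)` (DEF-1's ED.25 instance idiom; unfold to use).
HYPOTHESIS SHAPE; asserts nothing. [cite: Balaban1987RG1, (1.20)–(1.22) p.264, p.266] -/
def HessHistContOnBox₁₃Ax (θ : Stage13Params F N) (γ : ℝ) : Prop :=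
  letI := θ.instVβ₁; letI := θ.instVβ₂
  HessHistContOnBoxOf F (famOfRecord₁₃Ax F N θ) θ.ρ8 γ

variable {F N}

/-- ★ **(V-hess-cont-box) at `θ` ⟹ (T-β3) `PvolHistContOnBox₁₃Ax F N θ γ`** (§1 at the instance). [cite: Balaban1987RG1, (1.20)–(1.21) p.264] -/
theorem pvolHistContOnBox₁₃Ax_of_hess (θ : Stage13Params F N) {γ : ℝ} (h : HessHistContOnBox₁₃Ax F N θ γ) : PvolHistContOnBox₁₃Ax F N θ γ := by
  letI := θ.instVβ₁; letI := θ.instVβ₂; letI := θ.instιβ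
  exact pvolHistContOnBoxOf_of_hess F (famOfRecord₁₃Ax F N θ) θ.ρ8 θ.bV h

/-! ## §3  The (C) face with (T-β3) replaced by the Hessian row -/

/-- ★★ **(T-β1) + (T-β2) + (V-hess-cont-box) at `θ` ⟹ RUN-WISE SURVIVOR CONTINUITY `SurvCont (betaOfRecord₁₃Ax F N θ) γ₀`** (`0 < γ₀ ≤ γ ≤ θ.γ`) — DEF-1's
★★`survCont_betaOfRecord₁₃Ax_of_letters₁₃Ax` with its (T-β3) input produced by §2.  CONDITIONAL; every letter DISPLAYED, discharged by nobody; `stub_cont13` NOT closed.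
[cite: Balaban1987RG1, §1 pp.263–264, (1.20)–(1.22) p.264, (5.10) p.293] -/
theorem survCont_betaOfRecord₁₃Ax_of_locUnif_decay_hess (θ : Stage13Params F N) {γ γ₀ C δ₁ : ℝ} (hγ₀ : 0 < γ₀) (hle : γ₀ ≤ γ) (hγ : γ ≤ θ.γ)
    (h1 : PolLimitLocUnifOnBox₁₃Ax F N θ γ) (h2 : PlimDecayOnBox₁₃Ax F N θ γ C δ₁) (hH : HessHistContOnBox₁₃Ax F N θ γ) :
    SurvCont (betaOfRecord₁₃Ax F N θ) γ₀ :=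
  survCont_betaOfRecord₁₃Ax_of_letters₁₃Ax θ hγ₀ hle hγ h1 h2 (pvolHistContOnBox₁₃Ax_of_hess θ hH)

end Stage13Ax

/-! ## §4  At the K0 instance `thetaFill F a₀ ε₂₉`: the instance IS №10's displayed row -/

section K0

variable (F : T4Family) (a₀ ε₂₉ : ℝ)

/-- **`HessHistContOnBox₁₃Ax F 2 (thetaFill F a₀ ε₂₉) γ` IS THE K0 JUNCTION ROAD's (V-hess-cont-box) ROW** (✓`recordPvolContOnBoxAx_of_hessContOnBox`'s hypothesis, ✓p820772 :86)
BYTE-SHAPED (`famOfRecord₁₃Ax F 2 (thetaFill …) = recordTermsAx …`, `rfl`) — `Iff.rfl`.  So ONE row feeds (V-cont-box) there and (T-β3) here. [cite: Balaban1987RG1, (1.20)–(1.22) p.264 (bookkeeping)] -/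
theorem hessHistContOnBox₁₃Ax_thetaFill_iff (γ : ℝ) :
    HessHistContOnBox₁₃Ax F 2 (thetaFill F a₀ ε₂₉) γ ↔
      (letI θ := thetaFill F a₀ ε₂₉; letI := θ.instVβ₁; letI := θ.instVβ₂
       ∀ k K : ℕ, ContinuousOn (fun v : Fin (k + 1) → ℝ => fderiv ℝ (fderiv ℝ (B12PolarizationTensor120.expChart (recordTermsAx F a₀ ε₂₉ k v K) θ.ρ8)) 0) (FlowStep.Box γ k)) :=
  Iff.rfl

/-- **Both K0 letters from the one row**: (V-hess-cont-box) at `thetaFill` ⟹ (V-cont-box) `RecordPvolContOnBoxAx F a₀ ε₂₉ γ` (№10's junction input, `∃ᶠ K`) AND (T-β3)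
`PvolHistContOnBox₁₃Ax F 2 (thetaFill F a₀ ε₂₉) γ` (ED.25's K1∕K0 letter, `∀ K`). [cite: Balaban1987RG1, (1.20)–(1.22) p.264] -/
theorem recordPvolCont_and_pvolHistCont_of_hess_thetaFill {γ : ℝ} (h : HessHistContOnBox₁₃Ax F 2 (thetaFill F a₀ ε₂₉) γ) :
    RecordPvolContOnBoxAx F a₀ ε₂₉ γ ∧ PvolHistContOnBox₁₃Ax F 2 (thetaFill F a₀ ε₂₉) γ :=
  ⟨recordPvolContOnBoxAx_of_hessContOnBox F a₀ ε₂₉ h, pvolHistContOnBox₁₃Ax_of_hess (thetaFill F a₀ ε₂₉) h⟩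

end K0


/-! ## §5  The junction body's bill in the (T-β) currency at `thetaFill`: three NAMED kernel letters pay the |β|-box, row (i) and (C); ONE sign letter pays the floor (iv) -/

section Junction

variable (F : T4Family) (a₀ ε₂₉ : ℝ)

/-- ★★ **THE K0ᴬ–K1ᴬ JUNCTION BODY FROM DEF-1's THREE NAMED β-KERNEL LETTERS AT `thetaFill` + (L-negpart-box)**: at ONE radius `0 < a₀ ≤ a`, level `0 < γ₀ ≤ ½` (`ε₂₉ > 0`),
(T-β1) `PolLimitLocUnifOnBox₁₃Ax F 2 (thetaFill F a₀ ε₂₉) γ₀` + (T-β2) `PlimDecayOnBox₁₃Ax … γ₀ C δ₁` + (T-β3) `PvolHistContOnBox₁₃Ax … γ₀` + the signed floor letter `RecordPlimMomentNegPartOnBoxAx … γ₀ e`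
inhabit `CofinalBetaSocketAxBody F a` (✓`cofinalBetaSocketAxBody_of_plimBoxLetters` with `M := betaPrime510 4 C δ₁`; (L-cont-box) ⟸ (T-β1)+(T-β3), (L-dom-box) ⟸ (T-β2), all keys definitional at the
K0 instance).  CONDITIONAL; every letter is OPEN Bałaban-strength content ((T-β1)(T-β2) = [I] §1∕§5 at the record; the sign letter = [I] (5.38)–(5.44)), discharged by nobody; the junction's
consumer, K0ᴬ 27238 and K1ᴬ 27239 remain OPEN. [cite: Balaban1987RG1, Thm 2 (0.31) p.259, Thm 3 p.264, §1 pp.263–264, (1.21)–(1.22) p.264, (5.10) p.293, (5.38)–(5.44) pp.296–297] -/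
theorem cofinalBetaSocketAxBody_of_letters₁₃Ax_thetaFill_negPart {a γ₀ C δ₁ : ℝ} {e : ℕ → ℝ} (ha₀ : 0 < a₀) (hle : a₀ ≤ a) (hγ₀ : 0 < γ₀) (hγh : γ₀ ≤ 1 / 2)
    (hε : 0 < ε₂₉) (h1 : PolLimitLocUnifOnBox₁₃Ax F 2 (thetaFill F a₀ ε₂₉) γ₀) (h2 : PlimDecayOnBox₁₃Ax F 2 (thetaFill F a₀ ε₂₉) γ₀ C δ₁)
    (h3 : PvolHistContOnBox₁₃Ax F 2 (thetaFill F a₀ ε₂₉) γ₀) (hneg : RecordPlimMomentNegPartOnBoxAx F a₀ ε₂₉ γ₀ e) :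
    CofinalBetaSocketAxBody F a := by
  letI θ := thetaFill F a₀ ε₂₉; letI := θ.instVβ₁; letI := θ.instVβ₂; letI := θ.instιβ
  exact cofinalBetaSocketAxBody_of_plimBoxLetters F a₀ ε₂₉ ha₀ hle hγ₀ hγh hε (recordPlimAbsMomentOnBoxAx_of_plimDecayOnBoxOf F a₀ ε₂₉ h2)
    (plimContOnBoxOf_of_locUnif_of_histCont F (recordTermsAx F a₀ ε₂₉) θ.ρ8 θ.bV h1 h3)
    (plimMomentDominatedOnBoxOf_of_plimDecayOnBoxOf F (recordTermsAx F a₀ ε₂₉) θ.ρ8 θ.bV h2) hneg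

/-- ★★ **… WITH THE EVENTUAL SIGN (L-AF-box) `k₀` IN PLACE OF (L-negpart-box)** (asymptotic freedom in its qualitative form, [I] Thm 2 (0.31) `β > 0`; ✓`cofinalBetaSocketAxBody_of_plimBoxLetters_eventuallyNonneg`).
CONDITIONAL; nothing asserted. [cite: Balaban1987RG1, Thm 2 (0.31) p.259, Thm 3 p.264, §1 pp.263–264, (1.22) p.264, (5.10) p.293, (5.44) p.297] -/
theorem cofinalBetaSocketAxBody_of_letters₁₃Ax_thetaFill_eventuallyNonneg {a γ₀ C δ₁ : ℝ} {k₀ : ℕ} (ha₀ : 0 < a₀) (hle : a₀ ≤ a) (hγ₀ : 0 < γ₀) (hγh : γ₀ ≤ 1 / 2)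
    (hε : 0 < ε₂₉) (h1 : PolLimitLocUnifOnBox₁₃Ax F 2 (thetaFill F a₀ ε₂₉) γ₀) (h2 : PlimDecayOnBox₁₃Ax F 2 (thetaFill F a₀ ε₂₉) γ₀ C δ₁)
    (h3 : PvolHistContOnBox₁₃Ax F 2 (thetaFill F a₀ ε₂₉) γ₀) (hev : RecordPlimMomentEventuallyNonnegOnBoxAx F a₀ ε₂₉ γ₀ k₀) :
    CofinalBetaSocketAxBody F a := by
  letI θ := thetaFill F a₀ ε₂₉; letI := θ.instVβ₁; letI := θ.instVβ₂; letI := θ.instιβ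
  exact cofinalBetaSocketAxBody_of_plimBoxLetters_eventuallyNonneg F a₀ ε₂₉ ha₀ hle hγ₀ hγh hε (recordPlimAbsMomentOnBoxAx_of_plimDecayOnBoxOf F a₀ ε₂₉ h2)
    (plimContOnBoxOf_of_locUnif_of_histCont F (recordTermsAx F a₀ ε₂₉) θ.ρ8 θ.bV h1 h3)
    (plimMomentDominatedOnBoxOf_of_plimDecayOnBoxOf F (recordTermsAx F a₀ ε₂₉) θ.ρ8 θ.bV h2) hev

/-- ★★ **… WITH (T-β3) REPLACED BY THE HESSIAN ROW** (§2∕§4: (V-hess-cont-box) at `thetaFill` ⟹ (T-β3) there): (T-β1) + (T-β2) + (V-hess-cont-box) + (L-negpart-box) at one radius ⟹ the junction body.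
CONDITIONAL; nothing asserted. [cite: Balaban1987RG1, Thm 2 (0.31) p.259, Thm 3 p.264, (1.20)–(1.22) p.264, p.266, (5.10) p.293, (5.38)–(5.44) pp.296–297] -/
theorem cofinalBetaSocketAxBody_of_locUnif_decay_hess_thetaFill_negPart {a γ₀ C δ₁ : ℝ} {e : ℕ → ℝ} (ha₀ : 0 < a₀) (hle : a₀ ≤ a) (hγ₀ : 0 < γ₀) (hγh : γ₀ ≤ 1 / 2)
    (hε : 0 < ε₂₉) (h1 : PolLimitLocUnifOnBox₁₃Ax F 2 (thetaFill F a₀ ε₂₉) γ₀) (h2 : PlimDecayOnBox₁₃Ax F 2 (thetaFill F a₀ ε₂₉) γ₀ C δ₁)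
    (hH : HessHistContOnBox₁₃Ax F 2 (thetaFill F a₀ ε₂₉) γ₀) (hneg : RecordPlimMomentNegPartOnBoxAx F a₀ ε₂₉ γ₀ e) :
    CofinalBetaSocketAxBody F a :=
  cofinalBetaSocketAxBody_of_letters₁₃Ax_thetaFill_negPart F a₀ ε₂₉ ha₀ hle hγ₀ hγh hε h1 h2 (pvolHistContOnBox₁₃Ax_of_hess (thetaFill F a₀ ε₂₉) hH) hneg

/-- ★ **THE JUNCTION's BINDER `hβc` VERBATIM — `∀ F a, 0 < a → CofinalBetaSocketAxBody F a` — FROM THE THREE NAMED LETTERS + THE SIGN LETTER AT COFINALLY SMALL RADII.**  CONDITIONAL door: every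
conjunct of `H` is OPEN content; the junction's consumer, K0ᴬ, K1ᴬ, K3ᴬ remain OPEN; NODE O 0∕1; the Yang–Mills mass gap is NOT proved.
[cite: Balaban1987RG1, Thm 1 p.259, Thm 2 (0.31) p.259, Thm 3 p.264, §1 pp.263–264, (1.21)–(1.22) p.264, (5.10) p.293, (5.38)–(5.44) pp.296–297] -/
theorem cofinalBetaSocketAxBody_allRadii_of_letters₁₃Ax_thetaFill_negPart_cofinalRadii
    (H : ∀ (F : T4Family) (a : ℝ), 0 < a → ∃ a₀ : ℝ, 0 < a₀ ∧ a₀ ≤ a ∧ ∃ (γ₀ ε₂₉ C δ₁ : ℝ) (e : ℕ → ℝ), 0 < γ₀ ∧ γ₀ ≤ 1 / 2 ∧ 0 < ε₂₉ ∧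
      PolLimitLocUnifOnBox₁₃Ax F 2 (thetaFill F a₀ ε₂₉) γ₀ ∧ PlimDecayOnBox₁₃Ax F 2 (thetaFill F a₀ ε₂₉) γ₀ C δ₁ ∧ PvolHistContOnBox₁₃Ax F 2 (thetaFill F a₀ ε₂₉) γ₀ ∧
        RecordPlimMomentNegPartOnBoxAx F a₀ ε₂₉ γ₀ e) :
    ∀ (F : T4Family) (a : ℝ), 0 < a → CofinalBetaSocketAxBody F a := fun F a ha => by
  obtain ⟨a₀, ha₀, hle, γ₀, ε₂₉, C, δ₁, e, hγ₀, hγh, hε, h1, h2, h3, hneg⟩ := H F a ha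
  exact cofinalBetaSocketAxBody_of_letters₁₃Ax_thetaFill_negPart F a₀ ε₂₉ ha₀ hle hγ₀ hγh hε h1 h2 h3 hneg

/-- ★ **K0ᴬ BY NAME from the same supply** (through the socket's projection ✓`record13SepCoPHInhabitedAx_of_cofinalBetaSocketAxBody`; typed so that no lemma of §5 is idle — for the LEAF ALONE (T-β2) at cofinal
radii suffices, ✓`record13SepCoPHInhabitedAx_of_plimDecayOnBox_cofinalRadii`; the extra letters are what the JUNCTION's K1ᴬ-side rows (i)∕(iv)∕(C) read).  CONDITIONAL; K0ᴬ stmt-QuantumFields-27238 OPEN.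
[cite: Balaban1987RG1, Thm 1 p.259, Thm 2 (0.31) p.259, Thm 3 p.264, (1.21)–(1.22) p.264, (5.10) p.293, (5.42) p.297] -/
theorem record13SepCoPHInhabitedAx_of_letters₁₃Ax_thetaFill_negPart_cofinalRadii
    (H : ∀ (F : T4Family) (a : ℝ), 0 < a → ∃ a₀ : ℝ, 0 < a₀ ∧ a₀ ≤ a ∧ ∃ (γ₀ ε₂₉ C δ₁ : ℝ) (e : ℕ → ℝ), 0 < γ₀ ∧ γ₀ ≤ 1 / 2 ∧ 0 < ε₂₉ ∧
      PolLimitLocUnifOnBox₁₃Ax F 2 (thetaFill F a₀ ε₂₉) γ₀ ∧ PlimDecayOnBox₁₃Ax F 2 (thetaFill F a₀ ε₂₉) γ₀ C δ₁ ∧ PvolHistContOnBox₁₃Ax F 2 (thetaFill F a₀ ε₂₉) γ₀ ∧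
        RecordPlimMomentNegPartOnBoxAx F a₀ ε₂₉ γ₀ e) :
    Summit.QuantumFields.YangMills.Theses.BalabanUVNodes.Record13SepCoPHInhabitedAx :=
  record13SepCoPHInhabitedAx_of_cofinalBetaSocketAxBody (cofinalBetaSocketAxBody_allRadii_of_letters₁₃Ax_thetaFill_negPart_cofinalRadii H)

end Junction

end Summit.QuantumFields.YangMills.Theorems.K0AxHistContOfHess

end
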